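import Literature.NumberTheory.Sieve.MontgomeryVaughan1975Section6ExcT
import HarnessLib

/-!
# Montgomery–Vaughan (1975), §6, exceptional case, part R: (6.3~)–(6.8~), the remainder — PROVED

H. L. Montgomery, R. C. Vaughan, *The exceptional set in Goldbach's problem*, Acta Arith. 27
(1975) 353–370 [MontgomeryVaughanActa1975], §6, pp. 361–364. Second layer of the discharge of the
second conjunct (6.1͂7) of `section6_formulae`: in the presence of the exceptional character `χ̃`
(mod `r̃`, primitive) with real zero `β̃`, the decomposition of p. 361 reads
`S(χ, η) = 𝟙_{χ=χ₀} T(η) + 𝟙_{χ=χ̃χ₀} T̃(η) + W(χ, η)` (the middle term present only when `r̃ ∣ q`),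
and the argument of (6.3)–(6.8) (`Section6B`) goes through with the additional cross terms
`∫ T̃ W e` ((6.4~), (6.6~), p. 364), bounded by (6.7~) `∫|T̃|² ≤ X` and LEMMA 5.5 with `χ₂ = χ̃`.

* `IsExcChar χ̃ χ` — `χ` (mod `q`) is `χ̃χ₀`, i.e. induced by `χ̃`; `wFunExc`, `wNormExc` — the
  remainder `W(χ, η) = S(χ,η) − 𝟙T − 𝟙̃T̃` and `W(χ*)` of (6.5); `wFunExc_changeLevel`: for
  `χ = ψχ₀`, `ψ` primitive, this is `errSumExc … ψ` of `ErrorTerms` (so that the total is `errTotalExc`);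
* `majorArcMainTermExc` — the main terms at the modulus `q`:
  `φ(q)⁻² ∑_{χ,χ'} c_{χχ'}(−n) τ(χ̄)τ(χ̄') ∫_{−1/qQ}^{1/qQ} (𝟙T + 𝟙̃T̃)(𝟙'T + 𝟙̃'T̃) e(−nη) dη`
  (= the main term of (6.4) plus, when `r̃ ∣ q`, the two augmented terms of (6.4~); evaluated in part M);
* `norm_arcSum_sub_mainExc_le` — **(6.6)+(6.6~) at one modulus**;
* `linErrorExc_eq`, `excError_eq`, `bilErrorExc_eq` — regrouping by primitive characters, the new
  cross term being `∑_{r₂,ψ₂} lemma55Term χ̃ ψ₂ n q · W(ψ₂)`;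
* `majorArc_remainderExc_bound` — **(6.8~)**: for `X ≥ 0`, `Q ≥ 2`, `2P < Q`, `n ≥ 1`, `β ≤ 1`,
  `|R₁(n) − ∑_{q≤P} majorArcMainTermExc| ≤ 4e² (n/φ(n)) (4 X^{1/2} W + W²)`, `W = errTotalExc P Q X χ̃ β̃`.
-/

noncomputable section

open MeasureTheory Set Finset Real Complex Classical
open scoped FourierTransform

namespace Literature.NumberTheory.Sieve.MontgomeryVaughan1975

/-! ### The exceptional character among the characters mod `q` -/

/-- `χ` (mod `q`) is the character `χ̃χ₀` induced by the exceptional character `χ̃` (mod `r̃`):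
`r̃ ∣ q` and `χ = χ̃χ₀` (Montgomery–Vaughan 1975, p. 361). [cite: MontgomeryVaughanActa1975, §6 (6.2~)] -/
def IsExcChar {r : ℕ} (χe : DirichletCharacter ℂ r) {q : ℕ} (χ : DirichletCharacter ℂ q) : Prop :=
  ∃ h : r ∣ q, DirichletCharacter.changeLevel h χe = χ

/-- For `ψ` primitive mod `r' ∣ q` and `χ̃` primitive mod `r̃`: `ψχ₀ = χ̃χ₀` iff `r' = r̃` and `ψ = χ̃`
(pointwise on the naturals). [folklore] -/
theorem isExcChar_changeLevel_iff {r r' q : ℕ} [NeZero q] {χe : DirichletCharacter ℂ r}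
    (hχe : χe.IsPrimitive) (h : r' ∣ q) {ψ : DirichletCharacter ℂ r'} (hψ : ψ.IsPrimitive) :
    IsExcChar χe (DirichletCharacter.changeLevel h ψ) ↔
      (r' = r ∧ ∀ n : ℕ, ψ (n : ZMod r') = χe (n : ZMod r)) := by
  constructor
  · rintro ⟨h', he⟩
    have hrr : r' = r := by
      have h1 := congrArg DirichletCharacter.conductor he
      rw [DirichletCharacter.conductor_changeLevel, DirichletCharacter.conductor_changeLevel] at h1
      rw [DirichletCharacter.isPrimitive_def] at hχe hψ
      rw [hχe, hψ] at h1
      exact h1.symm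
    subst hrr
    have hψe : χe = ψ := DirichletCharacter.changeLevel_injective h he
    exact ⟨rfl, fun n => by rw [hψe]⟩
  · rintro ⟨hrr, hval⟩
    subst hrr
    haveI : NeZero r' := ⟨fun h0 => by subst h0; exact (NeZero.ne q) (Nat.eq_zero_of_zero_dvd h)⟩
    have hψe : ψ = χe := by
      apply MulChar.ext'
      intro x
      obtain ⟨n, rfl⟩ := ZMod.natCast_zmod_surjective x
      exact hval n
    exact ⟨h, by rw [hψe]⟩

/-- `∑_{χ mod q} 𝟙_{χ = χ̃χ₀} F(χ) = 𝟙_{r̃∣q} F(χ̃χ₀)`. [folklore] -/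
theorem sum_excInd_mul {r : ℕ} (χe : DirichletCharacter ℂ r) {q : ℕ} [NeZero q]
    (F : DirichletCharacter ℂ q → ℝ) :
    ∑ χ : DirichletCharacter ℂ q, (if IsExcChar χe χ then (1 : ℝ) else 0) * F χ =
      if h : r ∣ q then F (DirichletCharacter.changeLevel h χe) else 0 := by
  by_cases hr : r ∣ q
  · rw [dif_pos hr, Finset.sum_eq_single_of_mem (DirichletCharacter.changeLevel hr χe) (Finset.mem_univ _)]
    · rw [if_pos ⟨hr, rfl⟩, one_mul]
    · intro χ _ hne
      rw [if_neg, zero_mul]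
      rintro ⟨h', he⟩
      exact hne he.symm
  · rw [dif_neg hr]
    refine Finset.sum_eq_zero fun χ _ => ?_
    rw [if_neg, zero_mul]
    rintro ⟨h', _⟩
    exact hr h'

/-- Complex-valued version: `∑_{χ mod q} 𝟙_{χ = χ̃χ₀} F(χ) = 𝟙_{r̃∣q} F(χ̃χ₀)`. [folklore] -/
theorem sum_excIndC_mul {r : ℕ} (χe : DirichletCharacter ℂ r) {q : ℕ} [NeZero q]
    (F : DirichletCharacter ℂ q → ℂ) :
    ∑ χ : DirichletCharacter ℂ q, (if IsExcChar χe χ then (1 : ℂ) else 0) * F χ =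
      if h : r ∣ q then F (DirichletCharacter.changeLevel h χe) else 0 := by
  by_cases hr : r ∣ q
  · rw [dif_pos hr, Finset.sum_eq_single_of_mem (DirichletCharacter.changeLevel hr χe) (Finset.mem_univ _)]
    · rw [if_pos ⟨hr, rfl⟩, one_mul]
    · intro χ _ hne
      rw [if_neg, zero_mul]
      rintro ⟨h', he⟩
      exact hne he.symm
  · rw [dif_neg hr]
    refine Finset.sum_eq_zero fun χ _ => ?_
    rw [if_neg, zero_mul]
    rintro ⟨h', _⟩
    exact hr h'

/-! ### `W(χ, η)` and `W(χ*)` in the presence of the exceptional character -/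

/-- `W(χ, η) = S(χ, η) − 𝟙_{χ=χ₀} T(η) − 𝟙_{χ=χ̃χ₀} T̃(η)` for a character `χ` mod `q`
(Montgomery–Vaughan 1975, p. 361, exceptional case); for `q ≤ P` this is `W(χ*, η)`
(`wFunExc_changeLevel`). [cite: MontgomeryVaughanActa1975, §6 (6.2~)] -/
def wFunExc (P X : ℝ) {r : ℕ} (χe : DirichletCharacter ℂ r) (β : ℝ) {q : ℕ} (χ : DirichletCharacter ℂ q)
    (η : ℝ) : ℂ :=
  wFun P X χ η - if IsExcChar χe χ then excLinSum P X β η else 0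

/-- `W(χ*) = (∫_{−1/(r'Q)}^{1/(r'Q)} |W(χ,η)|² dη)^{1/2}`, `r'` the conductor of `χ`, exceptional case
(Montgomery–Vaughan 1975, (6.5)). [cite: MontgomeryVaughanActa1975, §6 (6.5)] -/
def wNormExc (P Q X : ℝ) {r : ℕ} (χe : DirichletCharacter ℂ r) (β : ℝ) {q : ℕ}
    (χ : DirichletCharacter ℂ q) : ℝ :=
  errNorm Q χ.conductor (wFunExc P X χe β χ)

/-- `S(χ, η) = (𝟙_{χ=χ₀} T(η) + 𝟙_{χ=χ̃χ₀} T̃(η)) + W(χ, η)`. [cite: MontgomeryVaughanActa1975, §6 (6.2~)] -/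
theorem charExpSum_eq_main_add_wFunExc (P X : ℝ) {r : ℕ} (χe : DirichletCharacter ℂ r) (β : ℝ) {q : ℕ}
    (χ : DirichletCharacter ℂ q) (η : ℝ) :
    charExpSum P X χ η =
      ((if χ = 1 then (1 : ℂ) else 0) * linSum P X η +
          (if IsExcChar χe χ then (1 : ℂ) else 0) * excLinSum P X β η) +
        wFunExc P X χe β χ η := by
  rw [wFunExc, wFun]
  split_ifs <;> ring

/-- For `ψ` primitive mod `r' ∣ q`, `q ≤ P`: `W(ψχ₀, ·) = W(ψ, ·)` as defined for primitive characters in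
the exceptional case (`errSumExc`). [cite: MontgomeryVaughanActa1975, §6 (6.2~)] -/
theorem wFunExc_changeLevel {P X : ℝ} {r : ℕ} {χe : DirichletCharacter ℂ r} (hχe : χe.IsPrimitive)
    (β : ℝ) {r' q : ℕ} [NeZero q] (h : r' ∣ q) (hq : 1 ≤ q) (hqP : (q : ℝ) ≤ P)
    {ψ : DirichletCharacter ℂ r'} (hψ : ψ.IsPrimitive) :
    wFunExc P X χe β (DirichletCharacter.changeLevel h ψ) = errSumExc P X χe β ψ := by
  funext η
  rw [wFunExc, errSumExc, wFun_changeLevel h hq hqP hψ]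
  congr 1
  by_cases hc : r' = r ∧ ∀ n : ℕ, ψ (n : ZMod r') = χe (n : ZMod r)
  · rw [if_pos hc, if_pos ((isExcChar_changeLevel_iff hχe h hψ).mpr hc)]
  · rw [if_neg hc, if_neg (fun h' => hc ((isExcChar_changeLevel_iff hχe h hψ).mp h'))]

/-- `W((ψχ₀)*) = W(ψ)` for `ψ` primitive mod `r' ∣ q`, `q ≤ P`, exceptional case.
[cite: MontgomeryVaughanActa1975, §6 (6.5)] -/
theorem wNormExc_changeLevel {P Q X : ℝ} {r : ℕ} {χe : DirichletCharacter ℂ r} (hχe : χe.IsPrimitive)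
    (β : ℝ) {r' q : ℕ} [NeZero q] (h : r' ∣ q) (hq : 1 ≤ q) (hqP : (q : ℝ) ≤ P)
    {ψ : DirichletCharacter ℂ r'} (hψ : ψ.IsPrimitive) :
    wNormExc P Q X χe β (DirichletCharacter.changeLevel h ψ) = errNorm Q r' (errSumExc P X χe β ψ) := by
  rw [wNormExc, wFunExc_changeLevel hχe β h hq hqP hψ, ψ.conductor_changeLevel h, hψ]

/-- Continuity of `W(χ, ·)`. [folklore] -/
theorem continuous_wFunExc (P X : ℝ) {r : ℕ} (χe : DirichletCharacter ℂ r) (β : ℝ) {q : ℕ}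
    (χ : DirichletCharacter ℂ q) : Continuous (wFunExc P X χe β χ) := by
  unfold wFunExc excLinSum
  have := continuous_wFun P X χ
  split_ifs <;> fun_prop

/-- Auxiliary. [folklore] -/
theorem wNormExc_nonneg (P Q X : ℝ) {r : ℕ} (χe : DirichletCharacter ℂ r) (β : ℝ) {q : ℕ}
    (χ : DirichletCharacter ℂ q) : 0 ≤ wNormExc P Q X χe β χ :=
  errNorm_nonneg _ _ _

/-- `(∫_{−1/(qQ)}^{1/(qQ)} |W(χ,η)|² dη)^{1/2} ≤ W(χ*)` (the range `1/(qQ)` is contained in `1/(r'Q)`).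
[cite: MontgomeryVaughanActa1975, §6 (6.5)] -/
theorem rpow_integral_norm_wFunExc_sq_le {P Q X : ℝ} (hQ : 0 < Q) {r : ℕ} (χe : DirichletCharacter ℂ r)
    (β : ℝ) {q : ℕ} [NeZero q] (χ : DirichletCharacter ℂ q) :
    (∫ η in (-(1 / (q * Q)))..(1 / (q * Q)), ‖wFunExc P X χe β χ η‖ ^ 2) ^ (1 / 2 : ℝ) ≤
      wNormExc P Q X χe β χ := by
  have hr0 : 0 < χ.conductor := Nat.pos_of_ne_zero (DirichletCharacter.conductor_ne_zero χ)
  have hrq : (χ.conductor : ℝ) ≤ q := by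
    exact_mod_cast Nat.le_of_dvd (NeZero.pos q) (DirichletCharacter.conductor_dvd_level χ)
  have hr0' : (0 : ℝ) < χ.conductor := by exact_mod_cast hr0
  have hq0 : (0 : ℝ) < q := by exact_mod_cast NeZero.pos q
  have hle : 1 / ((q : ℝ) * Q) ≤ 1 / (χ.conductor * Q) := by
    apply one_div_le_one_div_of_le (by positivity)
    exact mul_le_mul_of_nonneg_right hrq hQ.le
  have hpos : 0 < 1 / ((q : ℝ) * Q) := by positivity
  have hcont : Continuous fun η : ℝ => ‖wFunExc P X χe β χ η‖ ^ 2 := (continuous_wFunExc P X χe β χ).norm.pow 2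
  have hI0 : 0 ≤ ∫ η in (-(1 / ((q : ℝ) * Q)))..(1 / ((q : ℝ) * Q)), ‖wFunExc P X χe β χ η‖ ^ 2 :=
    intervalIntegral.integral_nonneg (by linarith) fun η _ => sq_nonneg _
  have hmono : ∫ η in (-(1 / ((q : ℝ) * Q)))..(1 / ((q : ℝ) * Q)), ‖wFunExc P X χe β χ η‖ ^ 2 ≤
      ∫ η in (-(1 / (χ.conductor * Q)))..(1 / (χ.conductor * Q)), ‖wFunExc P X χe β χ η‖ ^ 2 :=
    intervalIntegral.integral_mono_interval (by linarith) (by linarith) hle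
      (Filter.Eventually.of_forall fun η => sq_nonneg _) (hcont.intervalIntegrable _ _)
  rw [wNormExc, errNorm]
  exact Real.rpow_le_rpow hI0 hmono (by norm_num)

/-! ### Bilinear splitting of the arc integrals -/

/-- `∫ (A + B)(A' + B') e = ∫ A A' e + ∫ A B' e + ∫ B A' e + ∫ B B' e`. [folklore] -/
theorem integral_split_add {A B A' B' e : ℝ → ℂ} (hA : Continuous A) (hB : Continuous B)
    (hA' : Continuous A') (hB' : Continuous B') (he : Continuous e) (a b : ℝ) :
    ∫ η in a..b, (A η + B η) * (A' η + B' η) * e η =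
      (∫ η in a..b, A η * A' η * e η) + (∫ η in a..b, A η * B' η * e η) +
        (∫ η in a..b, B η * A' η * e η) + ∫ η in a..b, B η * B' η * e η := by
  have h1 : ∀ η, (A η + B η) * (A' η + B' η) * e η =
      A η * A' η * e η + A η * B' η * e η + B η * A' η * e η + B η * B' η * e η := fun η => by ring
  simp_rw [h1]
  have i1 : IntervalIntegrable (fun η => A η * A' η * e η) volume a b := Continuous.intervalIntegrable (by fun_prop) _ _
  have i2 : IntervalIntegrable (fun η => A η * B' η * e η) volume a b := Continuous.intervalIntegrable (by fun_prop) _ _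
  have i3 : IntervalIntegrable (fun η => B η * A' η * e η) volume a b := Continuous.intervalIntegrable (by fun_prop) _ _
  have i4 : IntervalIntegrable (fun η => B η * B' η * e η) volume a b := Continuous.intervalIntegrable (by fun_prop) _ _
  rw [intervalIntegral.integral_add ((i1.add i2).add i3) i4, intervalIntegral.integral_add (i1.add i2) i3,
    intervalIntegral.integral_add i1 i2]

/-- `∫ (δ T + δ̃ T̃) G e = δ ∫ T G e + δ̃ ∫ T̃ G e`. [folklore] -/
theorem integral_linComb_mul {T Tt G e : ℝ → ℂ} (hT : Continuous T) (hTt : Continuous Tt)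
    (hG : Continuous G) (he : Continuous e) (δ δt : ℂ) (a b : ℝ) :
    ∫ η in a..b, (δ * T η + δt * Tt η) * G η * e η =
      δ * (∫ η in a..b, T η * G η * e η) + δt * ∫ η in a..b, Tt η * G η * e η := by
  have h1 : ∀ η, (δ * T η + δt * Tt η) * G η * e η = δ * (T η * G η * e η) + δt * (Tt η * G η * e η) :=
    fun η => by ring
  simp_rw [h1]
  have i1 : IntervalIntegrable (fun η => δ * (T η * G η * e η)) volume a b := Continuous.intervalIntegrable (by fun_prop) _ _
  have i2 : IntervalIntegrable (fun η => δt * (Tt η * G η * e η)) volume a b := Continuous.intervalIntegrable (by fun_prop) _ _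
  rw [intervalIntegral.integral_add i1 i2, intervalIntegral.integral_const_mul, intervalIntegral.integral_const_mul]

/-- `∫ G (δ T + δ̃ T̃) e = δ ∫ G T e + δ̃ ∫ G T̃ e`. [folklore] -/
theorem integral_mul_linComb {T Tt G e : ℝ → ℂ} (hT : Continuous T) (hTt : Continuous Tt)
    (hG : Continuous G) (he : Continuous e) (δ δt : ℂ) (a b : ℝ) :
    ∫ η in a..b, G η * (δ * T η + δt * Tt η) * e η =
      δ * (∫ η in a..b, G η * T η * e η) + δt * ∫ η in a..b, G η * Tt η * e η := by
  have h1 : ∀ η, G η * (δ * T η + δt * Tt η) * e η = δ * (G η * T η * e η) + δt * (G η * Tt η * e η) :=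
    fun η => by ring
  simp_rw [h1]
  have i1 : IntervalIntegrable (fun η => δ * (G η * T η * e η)) volume a b := Continuous.intervalIntegrable (by fun_prop) _ _
  have i2 : IntervalIntegrable (fun η => δt * (G η * Tt η * e η)) volume a b := Continuous.intervalIntegrable (by fun_prop) _ _
  rw [intervalIntegral.integral_add i1 i2, intervalIntegral.integral_const_mul, intervalIntegral.integral_const_mul]

/-! ### The main terms at the modulus `q` -/

/-- The main terms at the modulus `q` in the exceptional case (first term of (6.4) and the first two
terms of (6.4~)): `φ(q)⁻² ∑_{χ,χ'} c_{χχ'}(−n) τ(χ̄)τ(χ̄') ∫_{−1/(qQ)}^{1/(qQ)}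
(𝟙_{χ=χ₀}T + 𝟙_{χ=χ̃χ₀}T̃)(𝟙_{χ'=χ₀}T + 𝟙_{χ'=χ̃χ₀}T̃) e(−nη) dη` (`0` for `q = 0`).
[cite: MontgomeryVaughanActa1975, §6 (6.4~)] -/
def majorArcMainTermExc (P Q X : ℝ) {r : ℕ} (χe : DirichletCharacter ℂ r) (β : ℝ) (n q : ℕ) : ℂ :=
  if hq : q = 0 then 0 else
    haveI : NeZero q := ⟨hq⟩
    ((q.totient : ℂ)⁻¹) ^ 2 * ∑ χ : DirichletCharacter ℂ q, ∑ χ' : DirichletCharacter ℂ q,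
      charGauss (χ * χ') ((-(n : ℤ) : ℤ) : ZMod q) *
        (gaussSum χ⁻¹ ZMod.stdAddChar * gaussSum χ'⁻¹ ZMod.stdAddChar *
          ∫ η in (-(1 / (q * Q)))..(1 / (q * Q)),
            ((if χ = 1 then (1 : ℂ) else 0) * linSum P X η +
                (if IsExcChar χe χ then (1 : ℂ) else 0) * excLinSum P X β η) *
              ((if χ' = 1 then (1 : ℂ) else 0) * linSum P X η +
                (if IsExcChar χe χ' then (1 : ℂ) else 0) * excLinSum P X β η) *
              (𝐞 (-(n * η)) : ℂ))

/-! ### (6.6)+(6.6~) at one modulus -/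

/-- **The remainder of (6.4)+(6.4~) at one modulus `q`** (Montgomery–Vaughan 1975, p. 362 and p. 364):
with `h = 1/(qQ) ≤ 1/2`, `τ̄(χ) = τ(χ̄)`, `W` the exceptional-case remainders,
`|∑'_a ∫_{−h}^{h} S(a/q+η)² e(−n(a/q+η)) dη − (main terms at q)|`
` ≤ φ(q)⁻² (2 X^{1/2} (|τ̄(χ₀)| ∑_χ |c_χ(−n)| |τ̄(χ)| W(χ*) + 𝟙_{r̃∣q} |τ̄(χ̃χ₀)| ∑_χ |c_{χ̃χ₀χ}(−n)| |τ̄(χ)| W(χ*))`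
`   + ∑_{χ,χ'} |c_{χχ'}(−n)| |τ̄(χ)| |τ̄(χ')| W(χ*) W(χ'*))`.
[cite: MontgomeryVaughanActa1975, §6 (6.6~)] -/
theorem norm_arcSum_sub_mainExc_le {P Q X : ℝ} (hX : 0 ≤ X) (hQ : 0 < Q) {r : ℕ} (χe : DirichletCharacter ℂ r)
    {β : ℝ} (hβ : β ≤ 1) {q : ℕ} [NeZero q] (hq : 1 ≤ q) (hqP : (q : ℝ) ≤ P) (hqQ : 2 ≤ (q : ℝ) * Q) (n : ℕ) :
    ‖(∑ a ∈ (Finset.Icc 1 q).filter (fun a : ℕ => a.Coprime q),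
        ∫ η in (-(1 / (q * Q)))..(1 / (q * Q)),
          expSum P X ((a : ℝ) / q + η) ^ 2 * (𝐞 (-(n * ((a : ℝ) / q + η))) : ℂ)) -
      majorArcMainTermExc P Q X χe β n q‖ ≤
      ((q.totient : ℝ)⁻¹) ^ 2 *
        (2 * X ^ (1 / 2 : ℝ) *
          (‖gaussSum (1 : DirichletCharacter ℂ q)⁻¹ ZMod.stdAddChar‖ *
              ∑ χ : DirichletCharacter ℂ q, ‖charGauss χ ((-(n : ℤ) : ℤ) : ZMod q)‖ *
                ‖gaussSum χ⁻¹ ZMod.stdAddChar‖ * wNormExc P Q X χe β χ +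
            ∑ χ : DirichletCharacter ℂ q, (if IsExcChar χe χ then (1 : ℝ) else 0) *
              ‖gaussSum χ⁻¹ ZMod.stdAddChar‖ *
              ∑ χ' : DirichletCharacter ℂ q, ‖charGauss (χ * χ') ((-(n : ℤ) : ℤ) : ZMod q)‖ *
                ‖gaussSum χ'⁻¹ ZMod.stdAddChar‖ * wNormExc P Q X χe β χ') +
        ∑ χ : DirichletCharacter ℂ q, ∑ χ' : DirichletCharacter ℂ q,
          ‖charGauss (χ * χ') ((-(n : ℤ) : ℤ) : ZMod q)‖ * ‖gaussSum χ⁻¹ ZMod.stdAddChar‖ *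
            ‖gaussSum χ'⁻¹ ZMod.stdAddChar‖ * wNormExc P Q X χe β χ * wNormExc P Q X χe β χ') := by
  -- notation
  set h : ℝ := 1 / (q * Q) with hh
  have hq0 : (0 : ℝ) < q := by exact_mod_cast hq
  have hh0 : 0 < h := by rw [hh]; positivity
  have hh2 : h ≤ 1 / 2 := by rw [hh]; exact one_div_le_one_div_of_le (by norm_num) hqQ
  set τ' : DirichletCharacter ℂ q → ℂ := fun χ => gaussSum χ⁻¹ ZMod.stdAddChar with hτ'
  set cG : DirichletCharacter ℂ q → ℂ := fun χ => charGauss χ ((-(n : ℤ) : ℤ) : ZMod q) with hcG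
  set T : ℝ → ℂ := linSum P X with hT
  set Tt : ℝ → ℂ := excLinSum P X β with hTt
  set Wf : DirichletCharacter ℂ q → ℝ → ℂ := fun χ => wFunExc P X χe β χ with hWf
  set e : ℝ → ℂ := fun η => (𝐞 (-(n * η)) : ℂ) with he
  set δ : DirichletCharacter ℂ q → ℂ := fun χ => if χ = 1 then 1 else 0 with hδ
  set δt : DirichletCharacter ℂ q → ℂ := fun χ => if IsExcChar χe χ then 1 else 0 with hδt
  set δr : DirichletCharacter ℂ q → ℝ := fun χ => if IsExcChar χe χ then 1 else 0 with hδr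
  set Mf : DirichletCharacter ℂ q → ℝ → ℂ := fun χ η => δ χ * T η + δt χ * Tt η with hMf
  set JM : DirichletCharacter ℂ q → DirichletCharacter ℂ q → ℂ :=
    fun χ χ' => ∫ η in (-h)..h, Mf χ η * Mf χ' η * e η with hJM
  set J₁ : DirichletCharacter ℂ q → ℂ := fun χ' => ∫ η in (-h)..h, T η * Wf χ' η * e η with hJ₁
  set Jt₁ : DirichletCharacter ℂ q → ℂ := fun χ' => ∫ η in (-h)..h, Tt η * Wf χ' η * e η with hJt₁
  set J₂ : DirichletCharacter ℂ q → ℂ := fun χ => ∫ η in (-h)..h, Wf χ η * T η * e η with hJ₂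
  set Jt₂ : DirichletCharacter ℂ q → ℂ := fun χ => ∫ η in (-h)..h, Wf χ η * Tt η * e η with hJt₂
  set J₃ : DirichletCharacter ℂ q → DirichletCharacter ℂ q → ℂ :=
    fun χ χ' => ∫ η in (-h)..h, Wf χ η * Wf χ' η * e η with hJ₃
  set w : DirichletCharacter ℂ q → ℝ := fun χ => wNormExc P Q X χe β χ with hw
  have hTc : Continuous T := by rw [hT]; unfold linSum; fun_prop
  have hTtc : Continuous Tt := by rw [hTt]; unfold excLinSum; fun_prop
  have hWc : ∀ χ, Continuous (Wf χ) := fun χ => continuous_wFunExc P X χe β χ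
  have hec : Continuous e := by rw [he]; fun_prop
  have hMc : ∀ χ, Continuous (Mf χ) := fun χ => by simp only [hMf]; fun_prop
  have hδr_norm : ∀ χ, ‖δt χ‖ = δr χ := fun χ => by
    simp only [hδt, hδr]; split_ifs <;> simp
  have hδr0 : ∀ χ, 0 ≤ δr χ := fun χ => by simp only [hδr]; split_ifs <;> norm_num
  -- Step 1: (6.4) general form and the split of each `∫ S S' e`
  have hA := sum_coprime_integral_expSum_sq_eq (P := P) (X := X) hq hqP n h
  have hS : ∀ χ : DirichletCharacter ℂ q, ∀ η : ℝ, charExpSum P X χ η = Mf χ η + Wf χ η := by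
    intro χ η
    simp only [hMf, hδ, hδt, hT, hTt, hWf, wFunExc, wFun]
    split_ifs <;> ring
  have hI : ∀ χ χ' : DirichletCharacter ℂ q,
      ∫ η in (-h)..h, charExpSum P X χ η * charExpSum P X χ' η * (𝐞 (-(n * η)) : ℂ) =
        JM χ χ' + (δ χ * J₁ χ' + δt χ * Jt₁ χ') + (δ χ' * J₂ χ + δt χ' * Jt₂ χ) + J₃ χ χ' := by
    intro χ χ'
    have h4 := integral_split_add (hMc χ) (hWc χ) (hMc χ') (hWc χ') hec (-h) h
    have hl1 := integral_linComb_mul hTc hTtc (hWc χ') hec (δ χ) (δt χ) (-h) h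
    have hl2 := integral_mul_linComb hTc hTtc (hWc χ) hec (δ χ') (δt χ') (-h) h
    simp only [hJM, hJ₁, hJt₁, hJ₂, hJt₂, hJ₃]
    rw [← hl1, ← hl2, ← h4]
    refine intervalIntegral.integral_congr fun η _ => ?_
    simp only [hS]
    rfl
  -- Step 2: the algebra of the `δ`'s
  have hδsum : ∀ F : DirichletCharacter ℂ q → ℂ, ∑ χ : DirichletCharacter ℂ q, δ χ * F χ = F 1 :=
    fun F => by
      simp only [hδ]
      rw [Finset.sum_eq_single_of_mem 1 (Finset.mem_univ _)
        (fun χ _ hχ => by rw [if_neg hχ, zero_mul]), if_pos rfl, one_mul]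
  set E₁ : ℂ := ∑ χ' : DirichletCharacter ℂ q, cG χ' * (τ' 1 * τ' χ') * J₁ χ' +
    ∑ χ : DirichletCharacter ℂ q, ∑ χ' : DirichletCharacter ℂ q,
      δt χ * (cG (χ * χ') * (τ' χ * τ' χ') * Jt₁ χ') with hE₁
  set E₂ : ℂ := ∑ χ : DirichletCharacter ℂ q, cG χ * (τ' χ * τ' 1) * J₂ χ +
    ∑ χ : DirichletCharacter ℂ q, ∑ χ' : DirichletCharacter ℂ q,
      δt χ' * (cG (χ * χ') * (τ' χ * τ' χ') * Jt₂ χ) with hE₂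
  set E₃ : ℂ := ∑ χ : DirichletCharacter ℂ q, ∑ χ' : DirichletCharacter ℂ q,
    cG (χ * χ') * (τ' χ * τ' χ') * J₃ χ χ' with hE₃
  set EM : ℂ := ∑ χ : DirichletCharacter ℂ q, ∑ χ' : DirichletCharacter ℂ q,
    cG (χ * χ') * (τ' χ * τ' χ' * JM χ χ') with hEM
  have hsum : ∑ χ : DirichletCharacter ℂ q, ∑ χ' : DirichletCharacter ℂ q,
      cG (χ * χ') * (τ' χ * τ' χ' *
        (JM χ χ' + (δ χ * J₁ χ' + δt χ * Jt₁ χ') + (δ χ' * J₂ χ + δt χ' * Jt₂ χ) + J₃ χ χ')) =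
      EM + E₁ + E₂ + E₃ := by
    have hsplit : ∀ χ χ' : DirichletCharacter ℂ q,
        cG (χ * χ') * (τ' χ * τ' χ' *
          (JM χ χ' + (δ χ * J₁ χ' + δt χ * Jt₁ χ') + (δ χ' * J₂ χ + δt χ' * Jt₂ χ) + J₃ χ χ')) =
        cG (χ * χ') * (τ' χ * τ' χ' * JM χ χ') +
          (δ χ * (cG (χ * χ') * (τ' χ * τ' χ') * J₁ χ') + δt χ * (cG (χ * χ') * (τ' χ * τ' χ') * Jt₁ χ')) +
          (δ χ' * (cG (χ * χ') * (τ' χ * τ' χ') * J₂ χ) + δt χ' * (cG (χ * χ') * (τ' χ * τ' χ') * Jt₂ χ)) +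
          cG (χ * χ') * (τ' χ * τ' χ') * J₃ χ χ' := by
      intro χ χ'; ring
    simp_rw [hsplit, Finset.sum_add_distrib]
    have e2 : ∑ χ : DirichletCharacter ℂ q, ∑ χ' : DirichletCharacter ℂ q,
        δ χ * (cG (χ * χ') * (τ' χ * τ' χ') * J₁ χ') =
        ∑ χ' : DirichletCharacter ℂ q, cG χ' * (τ' 1 * τ' χ') * J₁ χ' := by
      simp_rw [← Finset.mul_sum]
      rw [hδsum (fun χ => ∑ i : DirichletCharacter ℂ q, cG (χ * i) * (τ' χ * τ' i) * J₁ i)]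
      simp only [one_mul]
    have e3 : ∑ χ : DirichletCharacter ℂ q, ∑ χ' : DirichletCharacter ℂ q,
        δ χ' * (cG (χ * χ') * (τ' χ * τ' χ') * J₂ χ) =
        ∑ χ : DirichletCharacter ℂ q, cG χ * (τ' χ * τ' 1) * J₂ χ := by
      refine Finset.sum_congr rfl fun χ _ => ?_
      rw [hδsum fun χ' => cG (χ * χ') * (τ' χ * τ' χ') * J₂ χ, mul_one]
    rw [e2, e3]
  have hmain : majorArcMainTermExc P Q X χe β n q = ((q.totient : ℂ)⁻¹) ^ 2 * EM := by
    rw [majorArcMainTermExc, dif_neg (NeZero.ne q)]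
  have hArepr : (∑ a ∈ (Finset.Icc 1 q).filter (fun a : ℕ => a.Coprime q),
        ∫ η in (-h)..h, expSum P X ((a : ℝ) / q + η) ^ 2 * (𝐞 (-(n * ((a : ℝ) / q + η))) : ℂ)) -
      majorArcMainTermExc P Q X χe β n q =
      ((q.totient : ℂ)⁻¹) ^ 2 * (E₁ + E₂ + E₃) := by
    rw [hA, hmain]
    simp_rw [hI]
    rw [hsum]; ring
  -- Step 3: Cauchy–Schwarz bounds
  have hX2 : 0 ≤ X ^ (1 / 2 : ℝ) := Real.rpow_nonneg hX _
  have hTn : (∫ η in (-h)..h, ‖T η‖ ^ 2) ^ (1 / 2 : ℝ) ≤ X ^ (1 / 2 : ℝ) :=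
    rpow_integral_norm_linSum_sq_le hh0.le hh2 hX
  have hTtn : (∫ η in (-h)..h, ‖Tt η‖ ^ 2) ^ (1 / 2 : ℝ) ≤ X ^ (1 / 2 : ℝ) :=
    rpow_integral_norm_excLinSum_sq_le hh0.le hh2 hX hβ
  have hWn : ∀ χ, (∫ η in (-h)..h, ‖Wf χ η‖ ^ 2) ^ (1 / 2 : ℝ) ≤ w χ := fun χ =>
    rpow_integral_norm_wFunExc_sq_le hQ χe β χ
  have hw0 : ∀ χ, 0 ≤ w χ := fun χ => wNormExc_nonneg P Q X χe β χ
  have hI0 : ∀ f : ℝ → ℂ, 0 ≤ (∫ η in (-h)..h, ‖f η‖ ^ 2) ^ (1 / 2 : ℝ) := fun f =>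
    Real.rpow_nonneg (intervalIntegral.integral_nonneg (by linarith) fun η _ => sq_nonneg _) _
  have hJ₁b : ∀ χ', ‖J₁ χ'‖ ≤ X ^ (1 / 2 : ℝ) * w χ' := fun χ' =>
    (norm_integral_mul_mul_fourierChar_le hTc (hWc χ') n (by linarith)).trans
      (mul_le_mul hTn (hWn χ') (hI0 _) hX2)
  have hJt₁b : ∀ χ', ‖Jt₁ χ'‖ ≤ X ^ (1 / 2 : ℝ) * w χ' := fun χ' =>
    (norm_integral_mul_mul_fourierChar_le hTtc (hWc χ') n (by linarith)).trans
      (mul_le_mul hTtn (hWn χ') (hI0 _) hX2)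
  have hJ₂b : ∀ χ, ‖J₂ χ‖ ≤ w χ * X ^ (1 / 2 : ℝ) := fun χ =>
    (norm_integral_mul_mul_fourierChar_le (hWc χ) hTc n (by linarith)).trans
      (mul_le_mul (hWn χ) hTn (hI0 _) (hw0 χ))
  have hJt₂b : ∀ χ, ‖Jt₂ χ‖ ≤ w χ * X ^ (1 / 2 : ℝ) := fun χ =>
    (norm_integral_mul_mul_fourierChar_le (hWc χ) hTtc n (by linarith)).trans
      (mul_le_mul (hWn χ) hTtn (hI0 _) (hw0 χ))
  have hJ₃b : ∀ χ χ', ‖J₃ χ χ'‖ ≤ w χ * w χ' := fun χ χ' =>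
    (norm_integral_mul_mul_fourierChar_le (hWc χ) (hWc χ') n (by linarith)).trans
      (mul_le_mul (hWn χ) (hWn χ') (hI0 _) (hw0 χ))
  -- Step 4: assemble
  have hE₁b : ‖E₁‖ ≤ X ^ (1 / 2 : ℝ) * (‖τ' 1‖ * ∑ χ : DirichletCharacter ℂ q, ‖cG χ‖ * ‖τ' χ‖ * w χ +
      ∑ χ : DirichletCharacter ℂ q, δr χ * ‖τ' χ‖ *
        ∑ χ' : DirichletCharacter ℂ q, ‖cG (χ * χ')‖ * ‖τ' χ'‖ * w χ') := by
    rw [hE₁]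
    refine (norm_add_le _ _).trans ?_
    rw [mul_add]
    apply add_le_add
    · rw [Finset.mul_sum, Finset.mul_sum]
      refine (norm_sum_le _ _).trans (Finset.sum_le_sum fun χ' _ => ?_)
      rw [norm_mul, norm_mul, norm_mul]
      calc ‖cG χ'‖ * (‖τ' 1‖ * ‖τ' χ'‖) * ‖J₁ χ'‖ ≤ ‖cG χ'‖ * (‖τ' 1‖ * ‖τ' χ'‖) * (X ^ (1 / 2 : ℝ) * w χ') :=
            mul_le_mul_of_nonneg_left (hJ₁b χ') (by positivity)
        _ = X ^ (1 / 2 : ℝ) * (‖τ' 1‖ * (‖cG χ'‖ * ‖τ' χ'‖ * w χ')) := by ring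
    · rw [Finset.mul_sum]
      refine (norm_sum_le _ _).trans (Finset.sum_le_sum fun χ _ => ?_)
      rw [Finset.mul_sum, Finset.mul_sum]
      refine (norm_sum_le _ _).trans (Finset.sum_le_sum fun χ' _ => ?_)
      rw [norm_mul, norm_mul, norm_mul, norm_mul, hδr_norm]
      calc δr χ * (‖cG (χ * χ')‖ * (‖τ' χ‖ * ‖τ' χ'‖) * ‖Jt₁ χ'‖)
          ≤ δr χ * (‖cG (χ * χ')‖ * (‖τ' χ‖ * ‖τ' χ'‖) * (X ^ (1 / 2 : ℝ) * w χ')) :=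
            mul_le_mul_of_nonneg_left (mul_le_mul_of_nonneg_left (hJt₁b χ') (by positivity)) (hδr0 χ)
        _ = X ^ (1 / 2 : ℝ) * (δr χ * ‖τ' χ‖ * (‖cG (χ * χ')‖ * ‖τ' χ'‖ * w χ')) := by ring
  have hE₂b : ‖E₂‖ ≤ X ^ (1 / 2 : ℝ) * (‖τ' 1‖ * ∑ χ : DirichletCharacter ℂ q, ‖cG χ‖ * ‖τ' χ‖ * w χ +
      ∑ χ : DirichletCharacter ℂ q, δr χ * ‖τ' χ‖ *
        ∑ χ' : DirichletCharacter ℂ q, ‖cG (χ * χ')‖ * ‖τ' χ'‖ * w χ') := by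
    rw [hE₂]
    refine (norm_add_le _ _).trans ?_
    rw [mul_add]
    apply add_le_add
    · rw [Finset.mul_sum, Finset.mul_sum]
      refine (norm_sum_le _ _).trans (Finset.sum_le_sum fun χ _ => ?_)
      rw [norm_mul, norm_mul, norm_mul]
      calc ‖cG χ‖ * (‖τ' χ‖ * ‖τ' 1‖) * ‖J₂ χ‖ ≤ ‖cG χ‖ * (‖τ' χ‖ * ‖τ' 1‖) * (w χ * X ^ (1 / 2 : ℝ)) :=
            mul_le_mul_of_nonneg_left (hJ₂b χ) (by positivity)
        _ = X ^ (1 / 2 : ℝ) * (‖τ' 1‖ * (‖cG χ‖ * ‖τ' χ‖ * w χ)) := by ring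
    · -- swap the summations and use `c_{χχ'} = c_{χ'χ}`
      rw [Finset.sum_comm]
      rw [Finset.mul_sum]
      refine (norm_sum_le _ _).trans (Finset.sum_le_sum fun χ' _ => ?_)
      rw [Finset.mul_sum, Finset.mul_sum]
      refine (norm_sum_le _ _).trans (Finset.sum_le_sum fun χ _ => ?_)
      rw [norm_mul, norm_mul, norm_mul, norm_mul, hδr_norm, mul_comm χ χ']
      calc δr χ' * (‖cG (χ' * χ)‖ * (‖τ' χ‖ * ‖τ' χ'‖) * ‖Jt₂ χ‖)
          ≤ δr χ' * (‖cG (χ' * χ)‖ * (‖τ' χ‖ * ‖τ' χ'‖) * (w χ * X ^ (1 / 2 : ℝ))) :=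
            mul_le_mul_of_nonneg_left (mul_le_mul_of_nonneg_left (hJt₂b χ) (by positivity)) (hδr0 χ')
        _ = X ^ (1 / 2 : ℝ) * (δr χ' * ‖τ' χ'‖ * (‖cG (χ' * χ)‖ * ‖τ' χ‖ * w χ)) := by ring
  have hE₃b : ‖E₃‖ ≤ ∑ χ : DirichletCharacter ℂ q, ∑ χ' : DirichletCharacter ℂ q,
      ‖cG (χ * χ')‖ * ‖τ' χ‖ * ‖τ' χ'‖ * w χ * w χ' := by
    rw [hE₃]
    refine (norm_sum_le _ _).trans (Finset.sum_le_sum fun χ _ => ?_)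
    refine (norm_sum_le _ _).trans (Finset.sum_le_sum fun χ' _ => ?_)
    rw [norm_mul, norm_mul, norm_mul]
    calc ‖cG (χ * χ')‖ * (‖τ' χ‖ * ‖τ' χ'‖) * ‖J₃ χ χ'‖
        ≤ ‖cG (χ * χ')‖ * (‖τ' χ‖ * ‖τ' χ'‖) * (w χ * w χ') :=
          mul_le_mul_of_nonneg_left (hJ₃b χ χ') (by positivity)
      _ = _ := by ring
  have hφ : ‖((q.totient : ℂ)⁻¹) ^ 2‖ = ((q.totient : ℝ)⁻¹) ^ 2 := by
    rw [norm_pow, norm_inv, Complex.norm_natCast]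
  rw [hArepr, norm_mul, hφ]
  apply mul_le_mul_of_nonneg_left _ (by positivity)
  calc ‖E₁ + E₂ + E₃‖ ≤ ‖E₁‖ + ‖E₂‖ + ‖E₃‖ := norm_add₃_le
    _ ≤ _ := by
        have := add_le_add (add_le_add hE₁b hE₂b) hE₃b
        refine this.trans (le_of_eq ?_)
        simp only [hcG, hτ', hw, hδr]
        ring

/-! ### Regrouping by primitive characters, exceptional case -/

/-- **The linear error sum at `q`, regrouped** (exceptional case):
`φ(q)⁻² |τ(χ̄₀)| ∑_χ |c_χ(−n)| |τ(χ̄)| W(χ*) = ∑_{r'≤N} ∑*_{ψ mod r'} lemma55Term ψ 1 n q · W(ψ)`.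
[cite: MontgomeryVaughanActa1975, §6 (6.8)] -/
theorem linErrorExc_eq {P Q X : ℝ} {r : ℕ} {χe : DirichletCharacter ℂ r} (hχe : χe.IsPrimitive) (β : ℝ)
    {q N : ℕ} [NeZero q] (hq : 1 ≤ q) (hqN : q ≤ N) (hqP : (q : ℝ) ≤ P) (n : ℕ) :
    ((q.totient : ℝ)⁻¹) ^ 2 * ‖gaussSum (1 : DirichletCharacter ℂ q)⁻¹ ZMod.stdAddChar‖ *
        ∑ χ : DirichletCharacter ℂ q, ‖charGauss χ ((-(n : ℤ) : ℤ) : ZMod q)‖ *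
          ‖gaussSum χ⁻¹ ZMod.stdAddChar‖ * wNormExc P Q X χe β χ =
      ∑ r' ∈ Finset.Icc 1 N, ∑ ψ : DirichletCharacter ℂ r' with ψ.IsPrimitive,
        lemma55Term ψ (1 : DirichletCharacter ℂ 1) n q * errNorm Q r' (errSumExc P X χe β ψ) := by
  rw [Finset.mul_sum, sum_char_eq_sum_divisors_primitive]
  rw [← Finset.sum_subset (divisors_subset_Icc (NeZero.ne q) hqN) (fun r' hr hrn => by
    refine Finset.sum_eq_zero fun ψ _ => ?_
    rw [lemma55Term_eq_zero_left _ _ _ _ (not_dvd_of_mem_sdiff (NeZero.ne q)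
      (Finset.mem_sdiff.mpr ⟨hr, hrn⟩)), zero_mul])]
  refine Finset.sum_congr rfl fun r' hr => Finset.sum_congr rfl fun ψ hψ => ?_
  have hd : r' ∣ q := Nat.dvd_of_mem_divisors hr
  rw [Finset.mem_filter] at hψ
  rw [liftChar_of_dvd hd, wNormExc_changeLevel hχe β hd hq hqP hψ.2, ← linWeight_eq_lemma55Term hd ψ n]
  ring

/-- **The new cross term of (6.6~) at `q`, regrouped**:
`φ(q)⁻² ∑_χ 𝟙_{χ=χ̃χ₀} |τ(χ̄)| ∑_{χ'} |c_{χχ'}(−n)| |τ(χ̄')| W(χ'*) = ∑_{r₂≤N} ∑*_{ψ₂} lemma55Term χ̃ ψ₂ n q · W(ψ₂)`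
(both sides vanish unless `r̃ ∣ q`). [cite: MontgomeryVaughanActa1975, §6 (6.6~)] -/
theorem excError_eq {P Q X : ℝ} {r : ℕ} [NeZero r] {χe : DirichletCharacter ℂ r} (hχe : χe.IsPrimitive)
    (β : ℝ) {q N : ℕ} [NeZero q] (hq : 1 ≤ q) (hqN : q ≤ N) (hqP : (q : ℝ) ≤ P) (n : ℕ) :
    ((q.totient : ℝ)⁻¹) ^ 2 *
        ∑ χ : DirichletCharacter ℂ q, (if IsExcChar χe χ then (1 : ℝ) else 0) *
          ‖gaussSum χ⁻¹ ZMod.stdAddChar‖ *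
          ∑ χ' : DirichletCharacter ℂ q, ‖charGauss (χ * χ') ((-(n : ℤ) : ℤ) : ZMod q)‖ *
            ‖gaussSum χ'⁻¹ ZMod.stdAddChar‖ * wNormExc P Q X χe β χ' =
      ∑ r₂ ∈ Finset.Icc 1 N, ∑ ψ₂ : DirichletCharacter ℂ r₂ with ψ₂.IsPrimitive,
        lemma55Term χe ψ₂ n q * errNorm Q r₂ (errSumExc P X χe β ψ₂) := by
  have hsub := divisors_subset_Icc (NeZero.ne q) hqN
  have hassoc : ∀ χ : DirichletCharacter ℂ q, (if IsExcChar χe χ then (1 : ℝ) else 0) *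
      ‖gaussSum χ⁻¹ ZMod.stdAddChar‖ *
        ∑ χ' : DirichletCharacter ℂ q, ‖charGauss (χ * χ') ((-(n : ℤ) : ℤ) : ZMod q)‖ *
          ‖gaussSum χ'⁻¹ ZMod.stdAddChar‖ * wNormExc P Q X χe β χ' =
      (if IsExcChar χe χ then (1 : ℝ) else 0) * (‖gaussSum χ⁻¹ ZMod.stdAddChar‖ *
        ∑ χ' : DirichletCharacter ℂ q, ‖charGauss (χ * χ') ((-(n : ℤ) : ℤ) : ZMod q)‖ *
          ‖gaussSum χ'⁻¹ ZMod.stdAddChar‖ * wNormExc P Q X χe β χ') := fun χ => by ring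
  simp_rw [hassoc]
  rw [sum_excInd_mul]
  by_cases hr : r ∣ q
  · rw [dif_pos hr, Finset.mul_sum, Finset.mul_sum, sum_char_eq_sum_divisors_primitive]
    rw [← Finset.sum_subset hsub (fun r₂ hr₂ hr₂n => by
      refine Finset.sum_eq_zero fun ψ₂ _ => ?_
      rw [lemma55Term_eq_zero_right _ _ _ _ (not_dvd_of_mem_sdiff (NeZero.ne q)
        (Finset.mem_sdiff.mpr ⟨hr₂, hr₂n⟩)), zero_mul])]
    refine Finset.sum_congr rfl fun r₂ hr₂ => Finset.sum_congr rfl fun ψ₂ hψ₂ => ?_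
    have hd₂ : r₂ ∣ q := Nat.dvd_of_mem_divisors hr₂
    rw [Finset.mem_filter] at hψ₂
    rw [liftChar_of_dvd hd₂, wNormExc_changeLevel hχe β hd₂ hq hqP hψ₂.2,
      ← bilWeight_eq_lemma55Term hr hd₂ χe ψ₂ n]
    ring
  · rw [dif_neg hr, mul_zero]
    symm
    refine Finset.sum_eq_zero fun r₂ _ => Finset.sum_eq_zero fun ψ₂ _ => ?_
    rw [lemma55Term_eq_zero_left _ _ _ _ hr, zero_mul]

/-- **The bilinear error sum at `q`, regrouped** (exceptional case):
`φ(q)⁻² ∑_{χ,χ'} |c_{χχ'}(−n)| |τ(χ̄)| |τ(χ̄')| W(χ*) W(χ'*)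
 = ∑_{r₁,ψ₁} ∑_{r₂,ψ₂} lemma55Term ψ₁ ψ₂ n q · W(ψ₁) W(ψ₂)`. [cite: MontgomeryVaughanActa1975, §6 (6.8)] -/
theorem bilErrorExc_eq {P Q X : ℝ} {r : ℕ} {χe : DirichletCharacter ℂ r} (hχe : χe.IsPrimitive) (β : ℝ)
    {q N : ℕ} [NeZero q] (hq : 1 ≤ q) (hqN : q ≤ N) (hqP : (q : ℝ) ≤ P) (n : ℕ) :
    ((q.totient : ℝ)⁻¹) ^ 2 * ∑ χ : DirichletCharacter ℂ q, ∑ χ' : DirichletCharacter ℂ q,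
        ‖charGauss (χ * χ') ((-(n : ℤ) : ℤ) : ZMod q)‖ * ‖gaussSum χ⁻¹ ZMod.stdAddChar‖ *
          ‖gaussSum χ'⁻¹ ZMod.stdAddChar‖ * wNormExc P Q X χe β χ * wNormExc P Q X χe β χ' =
      ∑ r₁ ∈ Finset.Icc 1 N, ∑ ψ₁ : DirichletCharacter ℂ r₁ with ψ₁.IsPrimitive,
        ∑ r₂ ∈ Finset.Icc 1 N, ∑ ψ₂ : DirichletCharacter ℂ r₂ with ψ₂.IsPrimitive,
          lemma55Term ψ₁ ψ₂ n q * errNorm Q r₁ (errSumExc P X χe β ψ₁) *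
            errNorm Q r₂ (errSumExc P X χe β ψ₂) := by
  have hsub := divisors_subset_Icc (NeZero.ne q) hqN
  rw [Finset.mul_sum]
  have hinner : ∀ χ : DirichletCharacter ℂ q,
      ((q.totient : ℝ)⁻¹) ^ 2 * ∑ χ' : DirichletCharacter ℂ q,
        ‖charGauss (χ * χ') ((-(n : ℤ) : ℤ) : ZMod q)‖ * ‖gaussSum χ⁻¹ ZMod.stdAddChar‖ *
          ‖gaussSum χ'⁻¹ ZMod.stdAddChar‖ * wNormExc P Q X χe β χ * wNormExc P Q X χe β χ' =
      ∑ r₂ ∈ q.divisors, ∑ ψ₂ : DirichletCharacter ℂ r₂ with ψ₂.IsPrimitive,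
        ((q.totient : ℝ)⁻¹) ^ 2 *
          (‖charGauss (χ * liftChar r₂ q ψ₂) ((-(n : ℤ) : ℤ) : ZMod q)‖ * ‖gaussSum χ⁻¹ ZMod.stdAddChar‖ *
            ‖gaussSum (liftChar r₂ q ψ₂)⁻¹ ZMod.stdAddChar‖ * wNormExc P Q X χe β χ *
              wNormExc P Q X χe β (liftChar r₂ q ψ₂)) := by
    intro χ
    rw [Finset.mul_sum, sum_char_eq_sum_divisors_primitive]
  simp_rw [hinner]
  rw [sum_char_eq_sum_divisors_primitive]
  rw [← Finset.sum_subset hsub (fun r₁ hr₁ hr₁n => by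
    refine Finset.sum_eq_zero fun ψ₁ _ => Finset.sum_eq_zero fun r₂ _ => Finset.sum_eq_zero fun ψ₂ _ => ?_
    rw [lemma55Term_eq_zero_left _ _ _ _ (not_dvd_of_mem_sdiff (NeZero.ne q)
      (Finset.mem_sdiff.mpr ⟨hr₁, hr₁n⟩)), zero_mul, zero_mul])]
  refine Finset.sum_congr rfl fun r₁ hr₁ => Finset.sum_congr rfl fun ψ₁ hψ₁ => ?_
  rw [← Finset.sum_subset hsub (fun r₂ hr₂ hr₂n => by
    refine Finset.sum_eq_zero fun ψ₂ _ => ?_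
    rw [lemma55Term_eq_zero_right _ _ _ _ (not_dvd_of_mem_sdiff (NeZero.ne q)
      (Finset.mem_sdiff.mpr ⟨hr₂, hr₂n⟩)), zero_mul, zero_mul])]
  refine Finset.sum_congr rfl fun r₂ hr₂ => Finset.sum_congr rfl fun ψ₂ hψ₂ => ?_
  have hd₁ : r₁ ∣ q := Nat.dvd_of_mem_divisors hr₁
  have hd₂ : r₂ ∣ q := Nat.dvd_of_mem_divisors hr₂
  rw [Finset.mem_filter] at hψ₁ hψ₂
  rw [liftChar_of_dvd hd₁, liftChar_of_dvd hd₂, wNormExc_changeLevel hχe β hd₁ hq hqP hψ₁.2,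
    wNormExc_changeLevel hχe β hd₂ hq hqP hψ₂.2, ← bilWeight_eq_lemma55Term hd₁ hd₂ ψ₁ ψ₂ n]
  ring

/-! ### (6.8~): the major-arc remainder in the exceptional case -/

/-- **(6.6)–(6.8) with (6.6~), (6.7~) of Montgomery–Vaughan 1975** (p. 362–364: the error terms of
(6.4) and of (6.4~) are `≪ nφ(n)⁻¹ (X^{1/2} W + W²)`, by LEMMA 5.5): for `X ≥ 0`, `Q ≥ 2`, `2P < Q`,
`n ≥ 1`, `β̃ ≤ 1` and `χ̃` primitive mod `r̃`,
`|R₁(n) − ∑_{q≤P} majorArcMainTermExc| ≤ 4e² (n/φ(n)) (4 X^{1/2} W + W²)`,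
`W = errTotalExc P Q X χ̃ β̃` ((6.9), (6.5)). [cite: MontgomeryVaughanActa1975, §6 (6.8~)] -/
theorem majorArc_remainderExc_bound {P Q X : ℝ} (hX : 0 ≤ X) (hP : 0 ≤ P) (hQ2 : 2 ≤ Q) (hPQ : 2 * P < Q)
    {r : ℕ} [NeZero r] {χe : DirichletCharacter ℂ r} (hχe : χe.IsPrimitive) {β : ℝ} (hβ : β ≤ 1)
    {n : ℕ} (hn : n ≠ 0) :
    ‖majorArcIntegral P Q X n - ∑ q ∈ Finset.Icc 1 ⌊P⌋₊, majorArcMainTermExc P Q X χe β n q‖ ≤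
      4 * Real.exp 2 * ((n : ℝ) / (Nat.totient n : ℝ)) *
        (4 * X ^ (1 / 2 : ℝ) * errTotalExc P Q X χe β + errTotalExc P Q X χe β ^ 2) := by
  have hQ : 0 < Q := by linarith
  set N := ⌊P⌋₊ with hN
  have hmem : ∀ q ∈ Finset.Icc 1 N, 1 ≤ q ∧ q ≤ N ∧ (q : ℝ) ≤ P ∧ 2 ≤ (q : ℝ) * Q := by
    intro q hq
    rw [Finset.mem_Icc] at hq
    have hq1 : (1 : ℝ) ≤ q := by exact_mod_cast hq.1
    refine ⟨hq.1, hq.2, (Nat.cast_le.mpr hq.2).trans (Nat.floor_le hP), ?_⟩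
    nlinarith
  set E : (r' : ℕ) → DirichletCharacter ℂ r' → ℝ := fun r' ψ => errNorm Q r' (errSumExc P X χe β ψ) with hE
  have hE0 : ∀ (r' : ℕ) (ψ : DirichletCharacter ℂ r'), 0 ≤ E r' ψ := fun r' ψ => errNorm_nonneg _ _ _
  have hW : errTotalExc P Q X χe β = ∑ r' ∈ Finset.Icc 1 N, ∑ ψ : DirichletCharacter ℂ r' with ψ.IsPrimitive, E r' ψ := by
    rw [errTotalExc]
  -- Step 1: `R₁ = ∑_q A_q`
  have h1 : majorArcIntegral P Q X n = ∑ q ∈ Finset.Icc 1 N,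
      ∑ a ∈ (Finset.Icc 1 q).filter (fun a : ℕ => a.Coprime q),
        ∫ η in (-(1 / (q * Q)))..(1 / (q * Q)),
          expSum P X ((a : ℝ) / q + η) ^ 2 * (𝐞 (-(n * ((a : ℝ) / q + η))) : ℂ) := by
    rw [majorArcIntegral_eq_sum hPQ hP X n]
    refine Finset.sum_congr rfl fun q hq => Finset.sum_congr rfl fun a _ => ?_
    have hqQ : 0 < (q : ℝ) * Q := by
      have := (hmem q hq).1
      have : (0 : ℝ) < q := by exact_mod_cast this
      positivity
    exact integral_majorArc_eq _ hqQ a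
  -- Step 2: per-modulus bound
  have h2 : ∀ q ∈ Finset.Icc 1 N,
      ‖(∑ a ∈ (Finset.Icc 1 q).filter (fun a : ℕ => a.Coprime q),
        ∫ η in (-(1 / (q * Q)))..(1 / (q * Q)),
          expSum P X ((a : ℝ) / q + η) ^ 2 * (𝐞 (-(n * ((a : ℝ) / q + η))) : ℂ)) -
        majorArcMainTermExc P Q X χe β n q‖ ≤
      2 * X ^ (1 / 2 : ℝ) *
        ((∑ r' ∈ Finset.Icc 1 N, ∑ ψ : DirichletCharacter ℂ r' with ψ.IsPrimitive,
            lemma55Term ψ (1 : DirichletCharacter ℂ 1) n q * E r' ψ) +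
          ∑ r₂ ∈ Finset.Icc 1 N, ∑ ψ₂ : DirichletCharacter ℂ r₂ with ψ₂.IsPrimitive,
            lemma55Term χe ψ₂ n q * E r₂ ψ₂) +
      ∑ r₁ ∈ Finset.Icc 1 N, ∑ ψ₁ : DirichletCharacter ℂ r₁ with ψ₁.IsPrimitive,
        ∑ r₂ ∈ Finset.Icc 1 N, ∑ ψ₂ : DirichletCharacter ℂ r₂ with ψ₂.IsPrimitive,
          lemma55Term ψ₁ ψ₂ n q * E r₁ ψ₁ * E r₂ ψ₂ := by
    intro q hq
    obtain ⟨hq1, hqN, hqP, hqQ⟩ := hmem q hq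
    haveI : NeZero q := ⟨by omega⟩
    simp only [hE]
    rw [← linErrorExc_eq hχe β hq1 hqN hqP n, ← excError_eq hχe β hq1 hqN hqP n,
      ← bilErrorExc_eq hχe β hq1 hqN hqP n]
    refine (norm_arcSum_sub_mainExc_le hX hQ χe hβ hq1 hqP hqQ n).trans (le_of_eq ?_)
    ring
  -- Step 3: sum over `q` and swap the order of summation
  rw [h1, ← Finset.sum_sub_distrib]
  refine (norm_sum_le _ _).trans ((Finset.sum_le_sum h2).trans ?_)
  rw [Finset.sum_add_distrib, ← Finset.mul_sum, Finset.sum_add_distrib]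
  -- the linear sum
  have hlin : ∑ q ∈ Finset.Icc 1 N, ∑ r' ∈ Finset.Icc 1 N, ∑ ψ : DirichletCharacter ℂ r' with ψ.IsPrimitive,
      lemma55Term ψ (1 : DirichletCharacter ℂ 1) n q * E r' ψ ≤
      4 * Real.exp 2 * ((n : ℝ) / (Nat.totient n : ℝ)) * errTotalExc P Q X χe β := by
    rw [Finset.sum_comm]
    have : ∀ r' ∈ Finset.Icc 1 N, ∑ q ∈ Finset.Icc 1 N, ∑ ψ : DirichletCharacter ℂ r' with ψ.IsPrimitive,
        lemma55Term ψ (1 : DirichletCharacter ℂ 1) n q * E r' ψ =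
        ∑ ψ : DirichletCharacter ℂ r' with ψ.IsPrimitive,
          E r' ψ * ∑ q ∈ Finset.Icc 1 N, lemma55Term ψ (1 : DirichletCharacter ℂ 1) n q := by
      intro r' _
      rw [Finset.sum_comm]
      refine Finset.sum_congr rfl fun ψ _ => ?_
      rw [Finset.mul_sum]
      exact Finset.sum_congr rfl fun q _ => mul_comm _ _
    rw [Finset.sum_congr rfl this, hW]
    exact sum_weight_mul_sum_lemma55Term_le DirichletCharacter.isPrimitive_one_level_one hn _ _ hE0
  -- the exceptional cross sum
  have hexc : ∑ q ∈ Finset.Icc 1 N, ∑ r₂ ∈ Finset.Icc 1 N, ∑ ψ₂ : DirichletCharacter ℂ r₂ with ψ₂.IsPrimitive,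
      lemma55Term χe ψ₂ n q * E r₂ ψ₂ ≤
      4 * Real.exp 2 * ((n : ℝ) / (Nat.totient n : ℝ)) * errTotalExc P Q X χe β := by
    rw [Finset.sum_comm]
    have : ∀ r₂ ∈ Finset.Icc 1 N, ∑ q ∈ Finset.Icc 1 N, ∑ ψ₂ : DirichletCharacter ℂ r₂ with ψ₂.IsPrimitive,
        lemma55Term χe ψ₂ n q * E r₂ ψ₂ =
        ∑ ψ₂ : DirichletCharacter ℂ r₂ with ψ₂.IsPrimitive,
          E r₂ ψ₂ * ∑ q ∈ Finset.Icc 1 N, lemma55Term χe ψ₂ n q := by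
      intro r₂ _
      rw [Finset.sum_comm]
      refine Finset.sum_congr rfl fun ψ₂ _ => ?_
      rw [Finset.mul_sum]
      exact Finset.sum_congr rfl fun q _ => mul_comm _ _
    rw [Finset.sum_congr rfl this, hW]
    exact sum_weight_mul_sum_lemma55Term_le' hχe hn _ _ hE0
  -- the bilinear sum
  have hbil : ∑ q ∈ Finset.Icc 1 N, ∑ r₁ ∈ Finset.Icc 1 N, ∑ ψ₁ : DirichletCharacter ℂ r₁ with ψ₁.IsPrimitive,
      ∑ r₂ ∈ Finset.Icc 1 N, ∑ ψ₂ : DirichletCharacter ℂ r₂ with ψ₂.IsPrimitive,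
        lemma55Term ψ₁ ψ₂ n q * E r₁ ψ₁ * E r₂ ψ₂ ≤
      4 * Real.exp 2 * ((n : ℝ) / (Nat.totient n : ℝ)) * errTotalExc P Q X χe β ^ 2 := by
    rw [Finset.sum_comm]
    have hswap : ∀ r₁ ∈ Finset.Icc 1 N, ∑ q ∈ Finset.Icc 1 N, ∑ ψ₁ : DirichletCharacter ℂ r₁ with ψ₁.IsPrimitive,
        ∑ r₂ ∈ Finset.Icc 1 N, ∑ ψ₂ : DirichletCharacter ℂ r₂ with ψ₂.IsPrimitive,
          lemma55Term ψ₁ ψ₂ n q * E r₁ ψ₁ * E r₂ ψ₂ =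
        ∑ ψ₁ : DirichletCharacter ℂ r₁ with ψ₁.IsPrimitive, E r₁ ψ₁ *
          ∑ r₂ ∈ Finset.Icc 1 N, ∑ ψ₂ : DirichletCharacter ℂ r₂ with ψ₂.IsPrimitive,
            E r₂ ψ₂ * ∑ q ∈ Finset.Icc 1 N, lemma55Term ψ₁ ψ₂ n q := by
      intro r₁ _
      rw [Finset.sum_comm]
      refine Finset.sum_congr rfl fun ψ₁ _ => ?_
      rw [Finset.sum_comm, Finset.mul_sum]
      refine Finset.sum_congr rfl fun r₂ _ => ?_
      rw [Finset.sum_comm, Finset.mul_sum]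
      refine Finset.sum_congr rfl fun ψ₂ _ => ?_
      rw [Finset.mul_sum, Finset.mul_sum]
      refine Finset.sum_congr rfl fun q _ => ?_
      ring
    rw [Finset.sum_congr rfl hswap]
    have hinner : ∀ r₁ ∈ Finset.Icc 1 N, ∀ ψ₁ ∈ (Finset.univ : Finset (DirichletCharacter ℂ r₁)).filter
        (fun ψ₁ => ψ₁.IsPrimitive),
        ∑ r₂ ∈ Finset.Icc 1 N, ∑ ψ₂ : DirichletCharacter ℂ r₂ with ψ₂.IsPrimitive,
            E r₂ ψ₂ * ∑ q ∈ Finset.Icc 1 N, lemma55Term ψ₁ ψ₂ n q ≤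
          4 * Real.exp 2 * ((n : ℝ) / (Nat.totient n : ℝ)) * errTotalExc P Q X χe β := by
      intro r₁ hr₁ ψ₁ hψ₁
      rw [Finset.mem_Icc] at hr₁
      rw [Finset.mem_filter] at hψ₁
      haveI : NeZero r₁ := ⟨by omega⟩
      rw [hW]
      exact sum_weight_mul_sum_lemma55Term_le' hψ₁.2 hn _ _ hE0
    calc ∑ r₁ ∈ Finset.Icc 1 N, ∑ ψ₁ : DirichletCharacter ℂ r₁ with ψ₁.IsPrimitive,
          E r₁ ψ₁ * ∑ r₂ ∈ Finset.Icc 1 N, ∑ ψ₂ : DirichletCharacter ℂ r₂ with ψ₂.IsPrimitive,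
              E r₂ ψ₂ * ∑ q ∈ Finset.Icc 1 N, lemma55Term ψ₁ ψ₂ n q
        ≤ ∑ r₁ ∈ Finset.Icc 1 N, ∑ ψ₁ : DirichletCharacter ℂ r₁ with ψ₁.IsPrimitive,
            E r₁ ψ₁ * (4 * Real.exp 2 * ((n : ℝ) / (Nat.totient n : ℝ)) * errTotalExc P Q X χe β) := by
          refine Finset.sum_le_sum fun r₁ hr₁ => Finset.sum_le_sum fun ψ₁ hψ₁ => ?_
          exact mul_le_mul_of_nonneg_left (hinner r₁ hr₁ ψ₁ hψ₁) (hE0 r₁ ψ₁)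
      _ = 4 * Real.exp 2 * ((n : ℝ) / (Nat.totient n : ℝ)) * errTotalExc P Q X χe β ^ 2 := by
          simp_rw [← Finset.sum_mul]
          rw [← hW]; ring
  -- combine
  have hX2 : 0 ≤ X ^ (1 / 2 : ℝ) := Real.rpow_nonneg hX _
  calc 2 * X ^ (1 / 2 : ℝ) *
        ((∑ q ∈ Finset.Icc 1 N, ∑ r' ∈ Finset.Icc 1 N, ∑ ψ : DirichletCharacter ℂ r' with ψ.IsPrimitive,
            lemma55Term ψ (1 : DirichletCharacter ℂ 1) n q * E r' ψ) +
          ∑ q ∈ Finset.Icc 1 N, ∑ r₂ ∈ Finset.Icc 1 N, ∑ ψ₂ : DirichletCharacter ℂ r₂ with ψ₂.IsPrimitive,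
            lemma55Term χe ψ₂ n q * E r₂ ψ₂) +
        ∑ q ∈ Finset.Icc 1 N, ∑ r₁ ∈ Finset.Icc 1 N, ∑ ψ₁ : DirichletCharacter ℂ r₁ with ψ₁.IsPrimitive,
          ∑ r₂ ∈ Finset.Icc 1 N, ∑ ψ₂ : DirichletCharacter ℂ r₂ with ψ₂.IsPrimitive,
            lemma55Term ψ₁ ψ₂ n q * E r₁ ψ₁ * E r₂ ψ₂
      ≤ 2 * X ^ (1 / 2 : ℝ) *
          (4 * Real.exp 2 * ((n : ℝ) / (Nat.totient n : ℝ)) * errTotalExc P Q X χe β +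
            4 * Real.exp 2 * ((n : ℝ) / (Nat.totient n : ℝ)) * errTotalExc P Q X χe β) +
          4 * Real.exp 2 * ((n : ℝ) / (Nat.totient n : ℝ)) * errTotalExc P Q X χe β ^ 2 :=
        add_le_add (mul_le_mul_of_nonneg_left (add_le_add hlin hexc) (by positivity)) hbil
    _ = _ := by ring

end Literature.NumberTheory.Sieve.MontgomeryVaughan1975
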